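import Mathlib
import HarnessLib
import Literature.Computability.Complexity.CNF
import Literature.Computability.Complexity.PNPWave0
import Literature.Computability.Complexity.KSATReductions
import Literature.Computability.Complexity.StackBricksArith
import Literature.Computability.Complexity.TimeBounds

/-!
# PneNP / OverlapGapAlgebra — `SearchHardWindow`, line `IdeaSketch_r2_k6`: the variable-quotient transcoder is polynomial time

Support for crux `stmt-PneNP-2460` (`Summit.PneNP.PneNP.Theses.OverlapGapAlgebra.SearchHardWindow`),
line `IdeaSketch_r2_k6` (exact self-couplings), stub `stub_requotPolyTime`.

For every `q : ℕ` there is a polynomial-time word function `r` (tree `IsPolyTime`) sending the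
`encodingCNF`-code of any clause list `L : List (List (ℕ × Bool))` to the code of `L` with every
literal `(v, b)` replaced by `(v / q, b)` (`ℕ`-division, `v / 0 = 0`). The transcoder is the tower
of `Literature/Computability/Complexity/KSATReductions.lean` (`KSATRed.canonCNFFn =
canonListFnC 10 (canonListFnC 6 (canonPairFn canonF headBitFn))`, the canonical re-encoding of CNF
codes) with the numeral canonicaliser `canonF` replaced by "divide by `q`":

* literal map `canonPairFn (divFn ∘ fanoutFn canonF (fun _ => encodeNat q)) headBitFn`
  (`u ↦ ⟨⌜decodeNat (fst u) / q⌝, [head (snd u)]⟩`, `shwQR_litMap_eq`; size `≤ |u| + 5`,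
  `shwQR_length_litMap_le`, since `|⌜a / q⌝| ≤ |⌜a⌝|`);
* clause map `canonListFnC 6 litMap` (`shwQR_clauseMap_eq`: it is the code of the decoded clause
  with mapped literals; size `≤ 8 |u| + 2`);
* CNF map `canonListFnC 10 clauseMap` (`shwQR_cnfMap_eq`: the code of `(decCNF w).map (map g)`),
  in `FP` by `canonListFnC_mem_FP` / `canonPairFn_mem_FP` / `divFn_mem_FP` / `canonF_mem_FP`
  (`shwQR_cnfMap_mem_FP`), hence `IsPolyTime` (`polyTimeComputable_iff_nonempty`).

A MAP of items (rather than a canonicalisation) goes through `CanonCode.foldr_decList e d hci` with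
the "decoder" `d := g ∘ decLit` and `shwQR_decList_comp` (`decList (g ∘ d) = map g ∘ decList d`).
No new definitions: the transcoder is written out as a term in each statement.

Axioms: `propext`, `Classical.choice`, `Quot.sound`.
-/

-- `Summit.PneNP.PneNP.…` is the tree's mandated namespace (summit = sub-problem name).
set_option linter.dupNamespace false

namespace Summit.PneNP.PneNP.Theorems

open _root_.Computability Literature.Computability.Complexity
open Literature.Computability.Complexity.Brick Literature.Computability.Complexity.CanonCode
  Literature.Computability.Complexity.NegCNF Literature.Computability.Complexity.KSATRed

/-! ### The literal map `(v, b) ↦ (v / q, b)` on literal codes -/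

/-- Value of the literal map: `⟨⌜decodeNat (fst u) / q⌝, [head (snd u)]⟩` is the code of the
decoded literal with its variable divided by `q`. [folklore] -/
theorem shwQR_litMap_eq (q : ℕ) (u : List Bool) :
    canonPairFn (divFn ∘ fanoutFn canonF (fun _ => encodeNat q)) HashBricks.headBitFn u =
      encodingLiteral.encode (((fun l : ℕ × Bool => (l.1 / q, l.2)) ∘ decLit) u) := by
  rw [canonPairFn_apply, Function.comp_apply, fanoutFn_apply, divFn_boolPair, bitsToNat_canonF,
    bitsToNat_encodeNat, headBitFn_eq_encodeBool_decodeBool]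
  rfl

/-- Size of the literal map: `≤ |u| + 5` (the divided numeral is no longer than the canonical
numeral of the variable, `|canonF v| ≤ |v| + 1`, plus one polarity bit). [folklore] -/
theorem shwQR_length_litMap_le (q : ℕ) (u : List Bool) :
    (canonPairFn (divFn ∘ fanoutFn canonF (fun _ => encodeNat q)) HashBricks.headBitFn u).length ≤
      1 * u.length + 5 := by
  have hF : ∀ v, ((divFn ∘ fanoutFn canonF (fun _ => encodeNat q)) v).length ≤ 1 * v.length + 1 :=
    fun v => by
      rw [Function.comp_apply, fanoutFn_apply, divFn_boolPair, bitsToNat_encodeNat]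
      have h1 := length_canonF_le v
      have h2 : (encodeNat (bitsToNat (canonF v) / q)).length ≤ (canonF v).length :=
        (length_encodeNat_mono (Nat.div_le_self _ _)).trans (length_encodeNat_bitsToNat_le _)
      omega
  have h := length_canonPairFn_le_linear hF length_headBitFn_le u
  omega

/-! ### Mapped list decoding -/

/-- Reading items with a post-composed map is mapping the items read. [folklore] -/
theorem shwQR_decList_comp {α β : Type} (d : List Bool → α) (g : α → β) :
    ∀ (k : ℕ) (r : List Bool), decList (g ∘ d) k r = (decList d k r).map g
  | 0, _ => rfl
  | k + 1, r => by
    rw [decList, decList, List.map_cons, shwQR_decList_comp d g k, Function.comp_apply]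

/-! ### The clause map -/

/-- Value of the clause map: the code of the decoded clause with every literal `(v, b)` replaced by
`(v / q, b)`. [folklore] -/
theorem shwQR_clauseMap_eq (q : ℕ) (u : List Bool) :
    canonListFnC 6 (canonPairFn (divFn ∘ fanoutFn canonF (fun _ => encodeNat q)) HashBricks.headBitFn) u =
      encodingClause.encode ((List.map (fun l : ℕ × Bool => (l.1 / q, l.2)) ∘ decClause) u) := by
  rw [canonListFnC_apply (shwQR_length_litMap_le q) (by norm_num),
    ← foldr_decList encodingLiteral ((fun l : ℕ × Bool => (l.1 / q, l.2)) ∘ decLit) (shwQR_litMap_eq q),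
    shwQR_decList_comp decLit (fun l : ℕ × Bool => (l.1 / q, l.2))]
  show _ = boolPair (unaryEncodeNat ((decClause u).map _).length) (((decClause u).map _).foldr _ [])
  rw [List.length_map, show decClause u = decList decLit (boolUnpair u).1.length (boolUnpair u).2 from rfl,
    length_decList]

/-- Size of the clause map: `≤ 8 |u| + 2`. [folklore] -/
theorem shwQR_length_clauseMap_le (q : ℕ) (u : List Bool) :
    (canonListFnC 6 (canonPairFn (divFn ∘ fanoutFn canonF (fun _ => encodeNat q)) HashBricks.headBitFn) u).length ≤
      8 * u.length + 2 := by
  have h := length_canonListFnC_le (C := 6) (shwQR_length_litMap_le q) (by norm_num) u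
  omega

/-! ### The CNF map -/

/-- **Value of the CNF map**: the code of the decoded CNF with every literal `(v, b)` replaced by
`(v / q, b)`. [folklore] -/
theorem shwQR_cnfMap_eq (q : ℕ) (w : List Bool) :
    canonListFnC 10 (canonListFnC 6
        (canonPairFn (divFn ∘ fanoutFn canonF (fun _ => encodeNat q)) HashBricks.headBitFn)) w =
      encodingCNF.encode ((decCNF w).map (List.map fun l : ℕ × Bool => (l.1 / q, l.2))) := by
  rw [canonListFnC_apply (shwQR_length_clauseMap_le q) (by norm_num),
    ← foldr_decList encodingClause (List.map (fun l : ℕ × Bool => (l.1 / q, l.2)) ∘ decClause)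
      (shwQR_clauseMap_eq q),
    shwQR_decList_comp decClause (List.map fun l : ℕ × Bool => (l.1 / q, l.2))]
  show _ = boolPair (unaryEncodeNat ((decCNF w).map _).length) (((decCNF w).map _).foldr _ [])
  rw [List.length_map, show decCNF w = decList decClause (boolUnpair w).1.length (boolUnpair w).2 from rfl,
    length_decList]

/-- **The CNF map is in `FP`** (brick assembly). [folklore] -/
theorem shwQR_cnfMap_mem_FP (q : ℕ) :
    canonListFnC 10 (canonListFnC 6
        (canonPairFn (divFn ∘ fanoutFn canonF (fun _ => encodeNat q)) HashBricks.headBitFn)) ∈ FP :=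
  canonListFnC_mem_FP 10 (canonListFnC_mem_FP 6 (canonPairFn_mem_FP
    (comp_mem_FP divFn_mem_FP (fanoutFn_mem_FP canonF_mem_FP (const_mem_FP _))) HashBricks.headBitFn_mem_FP))

/-! ### The stub -/

/-- **The variable-quotient transcoder is polynomial time.** For every `q` there is a poly-time
word function sending the `encodingCNF`-code of any clause list `L` to the code of `L` with every
literal `(v, b)` replaced by `(v / q, b)` (on non-codewords: the same map applied to the total
decoding `decCNF`). [folklore] -/
theorem stub_requotPolyTime (q : ℕ) :
    ∃ r : List Bool → List Bool, IsPolyTime r ∧ ∀ L : List (List (ℕ × Bool)),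
      r (encodingCNF.encode L) =
        encodingCNF.encode (L.map fun c => c.map fun l => (l.1 / q, l.2)) :=
  ⟨canonListFnC 10 (canonListFnC 6
      (canonPairFn (divFn ∘ fanoutFn canonF (fun _ => encodeNat q)) HashBricks.headBitFn)),
    polyTimeComputable_iff_nonempty.1 (shwQR_cnfMap_mem_FP q), fun L => by
      rw [shwQR_cnfMap_eq, decCNF_encode]⟩

end Summit.PneNP.PneNP.Theorems
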